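import Summits.CriticalPhenomena.PercolationContinuityZ3.Theorems.SoloBlindSubcritical
import Literature.Probability.Percolation.ContinuityCriterion
import HarnessLib

/-!
# Each subcritical boundary-line sum is finite (sharpness)

Seat `solo-CriticalPhenomena-blind`.  Complement to `SoloBlindSubcritical`: for `p < p_c(ℤ³)` the
half-space boundary-line sum `T₀(p) = Σ_{w ≠ 0} P_p(0 ↔ (0,0,w) inside ℍ)` is FINITE
(`T0At_lt_top`), by the tree's sharpness of the phase transition (`DCT16.perc_sharpness_holds`,
Menshikov / Aizenman–Barsky / Duminil-Copin–Tassion: `P_p(0 ↔ ∂Λ_n) ≤ e^{-cn}`) and the first-exit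
bound `P_p(0 ↔ x) ≤ P_p(0 ↔ ∂Λ_n)` for `x ∉ Λ_n` (`tau_le_real_siteToBoundary`).

So the landed criterion reads: `p ↦ T₀(p)` is a non-decreasing (`T0At_mono`) finite function on
`[0, p_c)` with `T₀ = T₀(p_c) = sup_{p<p_c} T₀(p)` (`T0_eq_iSup_subcritical`), and
**`FinRung` holds as soon as this function is bounded by `2`** (`finRung_of_forall_subcritical`);
the whole content is the uniformity of the bound as `p ↑ p_c`.
-/

noncomputable section

namespace Summit.CriticalPhenomena.PercolationContinuityZ3.Theorems

open MeasureTheory Filter Topology Literature.Probability.Percolation Literature.Probability.LatticeModels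
open scoped ENNReal

/-- First exit: `τ_ℍ^p(w) ≤ P_p(0 ↔ ∂Λ_n)` whenever `n < |w|`. -/
theorem tauHAt_le_siteToBoundary (p : unitInterval) {w : ℤ} {n : ℕ} (hw : (n : ℤ) < |w|) :
    tauHAt p w ≤ bondPercolation (zdGraph 3) p (siteToBoundary 3 n) := by
  have hx : Function.update (0 : Site 3) 2 w ∉ box 3 n := by
    intro h
    have h2 := (mem_box.1 h) 2
    simp only [Function.update_self] at h2
    exact absurd (abs_le.2 ⟨h2.1, h2.2⟩) (not_le.2 hw)
  have h1 : tauHAt p w ≤ bondPercolation (zdGraph 3) p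
      (openConn (0 : Site 3) (Function.update (0 : Site 3) 2 w)) :=
    measure_mono fun ω hω => openClusterIn_subset_openCluster _ ω 0 hω
  have h2 := tau_le_real_siteToBoundary p hx
  rw [tau_def, measureReal_def, measureReal_def] at h2
  exact h1.trans ((ENNReal.toReal_le_toReal (measure_ne_top _ _) (measure_ne_top _ _)).1 h2)

/-- **Subcritical finiteness.** For `p < p_c(ℤ³)`, `T₀(p) < ∞`. -/
theorem T0At_lt_top (p : unitInterval) (hp : p < criticalProbI 3) : T0At p < ⊤ := by
  have hp' : (p : ℝ) < criticalProb (zdGraph 3) (0 : Site 3) := by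
    rw [← coe_criticalProbI]; exact_mod_cast hp
  obtain ⟨c, hc, hn⟩ := DCT16.perc_sharpness_holds (d := 3) (by norm_num) p hp'
  set g : ℤ → ℝ := fun w => Real.exp (-c * ((w.natAbs : ℝ) - 1)) with hg
  have hterm : ∀ w, Set.indicator {w : ℤ | w ≠ 0} (tauHAt p) w ≤ ENNReal.ofReal (g w) := by
    intro w
    by_cases hw : w ∈ {w : ℤ | w ≠ 0}
    · rw [Set.indicator_of_mem hw]
      have hw' : w ≠ 0 := hw
      have hpos : 1 ≤ w.natAbs := Int.natAbs_pos.2 hw'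
      have hlt : ((w.natAbs - 1 : ℕ) : ℤ) < |w| := by
        rw [Nat.cast_sub hpos, Int.natCast_natAbs]; simp
      refine (tauHAt_le_siteToBoundary p hlt).trans ?_
      rw [← ofReal_measureReal (measure_ne_top _ _)]
      refine ENNReal.ofReal_le_ofReal ((hn _).trans (le_of_eq ?_))
      simp [g, Nat.cast_sub hpos]
    · rw [Set.indicator_of_notMem hw]; exact bot_le
  have h1 : Summable fun n : ℕ => Real.exp (-c * ((n : ℝ) - 1)) := by
    have := Real.summable_exp_nat_mul_iff.2 (show -c < 0 by linarith)
    refine (this.mul_left (Real.exp c)).congr fun n => ?_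
    rw [← Real.exp_add]; congr 1; ring
  have hsum : Summable g := by
    rw [summable_int_iff_summable_nat_and_neg]
    exact ⟨by simpa [g] using h1, by simpa [g] using h1⟩
  have hg0 : ∀ w, 0 ≤ g w := fun w => (Real.exp_pos _).le
  calc T0At p = ∑' w, Set.indicator {w : ℤ | w ≠ 0} (tauHAt p) w := rfl
    _ ≤ ∑' w, ENNReal.ofReal (g w) := ENNReal.tsum_le_tsum hterm
    _ = ENNReal.ofReal (∑' w, g w) := (ENNReal.ofReal_tsum_of_nonneg hg0 hsum).symm
    _ < ⊤ := ENNReal.ofReal_lt_top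

/-- The subcritical line sums are finite and non-decreasing, with supremum `T₀`. -/
theorem T0At_lt_top_and_mono :
    (∀ p : unitInterval, p < criticalProbI 3 → T0At p < ⊤) ∧ Monotone T0At ∧
      T0 = ⨆ p : Set.Iio (criticalProbI 3), T0At p :=
  ⟨T0At_lt_top, T0At_mono, T0_eq_iSup_subcritical⟩

end Summit.CriticalPhenomena.PercolationContinuityZ3.Theorems

end
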